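import Literature.MathematicalPhysics.QuantumFieldTheory.Balaban1983to89.B1Eq324SmallFieldLeaf
import Literature.MathematicalPhysics.QuantumFieldTheory.Balaban1983to89.B1Ineq233LowerZeroFieldRegion
import Literature.MathematicalPhysics.QuantumFieldTheory.Balaban1983to89.B1Ineq233LowerRegularOnRegion

/-!
# `Balaban1983to89.B1Eq324SmallFieldLeafModels` — T. Bałaban, *(Higgs)₂,₃ quantum fields in a finite volume. I. A lower bound*,
Commun. Math. Phys. **85** (1982) 603–626 [Balaban1982Higgs1], (3.24) p. 616 and (3.59) p. 623: **THE SMALL-FIELD LEAF (a) OF THE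
CUMULANT EXPANSION — `|log⟨χ⟩| ≤ O(ε^κ)|T₁|` — WITH ITS PROP. 2.3 (2.33) INPUT DISCHARGED BY NAME ON THE MODEL CLASSES OF RECORD**
(zero background field on the whole torus — the printed *"case Ω = T_ε"* of pp. 609–610 — for BOTH Gaussian factors of
(3.24)/(3.59), and a (2.23)-regular background field for the scalar factor); theorems only, no definition, no `Prop`-valued fact.

statement-level skeleton of published theorems with citation tags; proofs where landed; nothing here is a claim about the Yang–Mills mass gap

PDF held: `paper:balaban1982-cmp85-higgs23-i` (journal page = PDF page + 602); pp. 610–611, 616, 623 [PDF 8–9, 14, 21]; the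
quotations of pp. 616/623 below are those checked by r14 in `B1Eq324SmallFieldLeaf`; pp. 610–611 were re-read this session in the
materialised text `~/.lit/texts/paper-balaban1982-cmp85-higgs23-i/p0008.txt` L2, `p0009.txt` L30–L34 (OCR; `Λ` renders as `A` there).

CITATION HEADER (lean-in-tree rule).  lit-balaban typed skeleton (HOME `run/shared/lean/pub/lit-balaban/`), Phase-2 proof seat
`lit-balaban-p29` gen 40 (`literature-prover-lit-balaban-p29-g40-0`; TAKING line HOME/STATUS.md 2026-08-24T17:21:02Z, free-target
protocol G.5-34 (d), window honoured).  SKELETON rows **B1.Eq3.24** / **B1.Eq3.59** (rows of record r12, fold owner r14; both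
`typed`, *"DISCHARGED MODULO NAMED LEAVES"*): r14's `B1Eq324SmallFieldLeaf` (p382558 ✓ / v1.1 p383003 ✓) RETIRES LEAF (a) on the
carrier *modulo ONE displayed covariance-diagonal bound* `σ²`, and its §8/§9 reduce `σ²` to print's Prop. 2.3 (2.33) LOWER HALF
`γ₀I ≦ aL^{−2}P(A) + Δ^{(k)}(Ω,A)` in the tree's level form, leaving (2.33) itself as the input (its HONEST SCOPE (ii): *"(2.33)
itself is not derived or claimed here"*).  THIS FILE feeds that input BY NAME from the files where the tree HAS PROVED the (2.33)
lower half — `B1Ineq233LowerZeroFieldTorus.ineq233_lower_zeroField_all` (zero field, whole torus, every level `k < K`, one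
constant `min{a, 8γ₀}/L²`, p15's `γ₀ = B2Prop31ZeroFieldConcrete.gamma0`) and `B1Ineq233LowerBackgroundTorus.ineq233_lower_printed_torus`
((2.23)-regular backgrounds, `e² ≤ E₀`) — so that leaf (a) holds on these model classes with NO `σ²` binder.  The bridge for the
VECTOR factor is the typer's `B1Eq230FluctCov.precOpA_zero_field`: the operator `a(L^{j+1}ε)^{−2}P + Δ^{(j)}` of `dμ_{C^{(j),L^jε}}(A′)`
(`HiggsFluctMeasure.precOp`) IS `precOpA (zeroCharge d) T_ε 0` — the (2.30) operator at zero field, `N = d` components, `Ω = T_ε`.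
USED BY NAME, NOTHING RESTATED OR EDITED: r14's `bondVar`/`siteVar`, `bondVar_le_of_ineq233_lower'`, `siteVar_le_of_ineq233_lower'`,
`abs_log_integral_chiFluctA_le`/`…φ_le`, `abs_log_integral_chiFluctA_thrF`/`…φ_thrF`, `integral_chiFluctA_pos`/`…φ_pos`,
`abs_log_mul_le`, `abs_log_le_of_tail_le_pow`, `thrF_sq_div`, `exp_neg_pFn_sq_le_pow`, `one_sub_integral_chiFluctA_le`/`…φ_le`;
p15/r14's `ineq233_lower_zeroField_all`, `lowConst_pos`, `ineq233_lower_zeroField_region(_largeBlocks)`; r14's `ineq233_lower_printed_torus` /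
`ineq233_lower_printed_region`; the typer's `precOpA_zero_field`; r15/p23's `extL`, `pieceF`, `Regions`.

THE SOURCE TEXT (verbatim, as quoted by r14).  p. 616: *"⟨χ exp(V)⟩ = exp[⟨V⟩ + (1/2!)⟨V²⟩^T + … + (1/n̄!)⟨V^{n̄}⟩^T + O(ε^κ)|T₁|],
κ > d. (3.24)"*, `⟨·⟩` *"the expectation value with respect to the measure dμ_{C⁽⁰⁾}(A′)dμ_{C⁽⁰⁾(B⁽¹⁾)}(φ′)"*; p. 623 (3.59) *"…
+ O(1)(L^kε)^κ|T₁^{(k)}|], κ > d"*; p. 611 Prop. 2.3: *"If a configuration A is regular on Ω in the sense defined in Proposition 2.1,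
then there exist positive constants δ₀, c₀, γ₀, γ₁ dependent on d and a, and independent of Λ, k, Ω and A, such that γ₀I ≦
aL^{−2}P(A) + Δ^{(k)} ≦ γ₁I, (2.33)"* (preceded by *"Here we will assume that the set Λ is a union of big blocks of T₁^{(k)}"* —
everything below holds for EVERY conditioning set `Λ`); pp. 609–610: *"… paper we will use the case Ω = T_ε only, but in the second part
the necessity of the considerations of more general Ω will arise"*.

WHAT IS PROVED (0 `sorry`, standard axioms; `μ₀², m² > 0`, `a > 0`, `L > 1` throughout).
§1 THE VECTOR FACTOR `χ(A′)` under `dμ_{C^{(j),L^jε}}` (`fluctMeasure P μ₀² a j`), HYPOTHESIS-FREE: `ineq233_lower_precOp` (the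
  (2.33) lower half FOR `precOp`: `(min{a,8γ₀}/L²)(L^jε)^{−2}‖f‖² ≤ ⟨f,(a(L^{j+1}ε)^{−2}P + Δ^{(j)})f⟩`, every `j < K`, `L^jε ≤ 1`),
  **`bondVar_le_zeroField`** (`bondVar b ≤ (L²/min{a,8γ₀})·(L^jε)^{−(d−2)}` for every bond), **`abs_log_integral_chiFluctA_thrF_zeroField`**
  (`|log⟨χ(A′)⟩| ≤ 4d|T^{(j)}|(L^jε)^K` in the tree's `ε`-units, given only the scale-free smallness `e^{−p₁(L^jε)²/(2dσ₁²)} ≤ (L^jε)^K`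
  and `2d|T^{(j)}|(L^jε)^K ≤ ½`), `integral_chiFluctA_thrF_pos_zeroField` (`⟨χ(A′)⟩ > 0`), and the PRINTED form
  **`abs_log_integral_chiFluctA_zeroField_printed`**: for every `d ≥ 1`, `L > 1`, `a, μ₀² > 0`, `b₁ > 0`, `p₁ > ½` and every `K`
  there is `s₁ > 0` (a function of these numbers only) such that for EVERY torus of the family with parameters `(d, L)`, every level
  `j < K_P` with `L^jε ≤ s₁` and `2d|T^{(j)}|(L^jε)^K ≤ ½`: `|log⟨χ(A′)⟩| ≤ 4d|T^{(j)}|(L^jε)^K` — print's `O(ε^κ)|T₁|` for the vector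
  factor with NO covariance hypothesis left.
§2 THE SCALAR FACTOR `χ(φ′)` under `dμ_{C^{(k)}_Λ(T_ε,0)}` (`condGauss C T_ε 0 m² a k Λ`, ANY charge data `C`, any `N ≥ 1`
  components, EVERY conditioning set `Λ`), HYPOTHESIS-FREE: **`siteVar_le_zeroField`**, **`abs_log_integral_chiFluctφ_thrF_zeroField`**,
  `integral_chiFluctφ_thrF_pos_zeroField`, **`abs_log_integral_chiFluctφ_zeroField_printed`** (same shape, `N` for `d`).
§3 THE PRODUCT MEASURE `dμ_{C^{(k)}}(A′)dμ_{C^{(k)}_Λ(T_ε,0)}(φ′)` of (3.24)/(3.59) at zero background: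
  **`abs_log_integral_chi_prod_thrF_zeroField`** (`|log⟨χ(A′)χ(φ′)⟩| ≤ 4d|T|(L^kε)^K + 4N|T|(L^kε)^K`), `integral_chi_prod_thrF_pos_zeroField`,
  and **`abs_log_integral_chi_prod_zeroField_printed`** (the `∃ s₁` form: `≤ 4(d+N)|T^{(k)}|(L^kε)^K`) — leaf (a) of p27's
  `B1Eq324CumulantTaylor.eq324_chi` in its `ha`/`hpos` shapes for THE MODEL INSTANCE of rows B1.Eq3.24/3.59 (zero background,
  `Ω = T_ε`), nothing assumed beyond the smallness of `L^kε`.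
§4 THE SCALAR FACTOR AT A (2.23)-REGULAR BACKGROUND `A` on `T_ε` (`d ≤ …` none; `1 ≤ k = j+1 < K`, at least two `(k+1)`-sites per
  direction, `e² ≤ E₀`, `L^kδ ≤ c|e|`): **`siteVar_le_regular_torus`** (`∃ E₀ > 0, ∃ σ₁² > 0` depending on `(d, L, a, m², c)` only, with
  `siteVar ≤ σ₁²(L^kε)^{−(d−2)}` for every conditioning set `Λ`) and **`abs_log_integral_chiFluctφ_regular_printed`** (the `∃ E₀, s₁` form
  of leaf (a) for `χ(φ′)` under `dμ_{C^{(k)}_Λ(T_ε,A)}`), from r14's `ineq233_lower_printed_torus` BY NAME.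
§5 THE SCALAR FACTOR ON THE PRINTED REGIONS `Ω = B^k(Λ_k)` AT ZERO FIELD: a SUPPORTED-FIELD variant of r14's §9
  (`siteInner_condCov232_self_le_of_supported`, `siteVar_le_of_ineq233_lower_supported`: the (2.33) lower half is needed only for the
  fields supported in a set `S ⊇ Λ`, since `C^{(k)}_Λ g` is supported in `Λ`) — the shape in which the tree's region files state
  (2.33)ₗ — then, from r14's `B1Ineq233LowerZeroFieldRegion.ineq233_lower_zeroField_region(_largeBlocks)` BY NAME,
  `ineq233_lower_zeroField_region_supported`, **`siteVar_le_zeroField_region`** / `…_largeBlocks` (for `Λ ⊆ Λ_k`, `Λ_k` a union of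
  blocks / of big blocks, `Ω = B^k(Λ_k)` = `B2Eq328ConcretePieces.pieceF`) and **`abs_log_integral_chiFluctφ_thrF_zeroField_region`**
  (leaf (a) + positivity for `χ(φ′)` under `dμ_{C^{(k)}_Λ(B^k(Λ_k),0)}`) — print's own setting p. 611 *"the set Λ is a union of big
  blocks"*, `Λ ⊂ Ω^{(k)}`.
§6 THE SCALAR FACTOR ON THE PRINTED REGIONS AT A BACKGROUND REGULAR ON THE REGION (print's Prop. 2.3 setting verbatim:
  *"If a configuration A is regular on Ω"*, `Ω = B^k(Λ_k)`, `Λ ⊆ Λ_k`): **`siteVar_le_regular_region`** (`∃ E₀, σ₁²`) and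
  **`abs_log_integral_chiFluctφ_regular_region_printed`** (`∃ E₀, s₁`), from r14's `B1Ineq233LowerRegularOnRegion.ineq233_lower_printed_region`
  through §5's supported-field variant.
HONEST SCOPE.  (i) Zero head weight: rows B1.Eq3.24/3.59 keep `typed` (leaves (b), (c) = the lemma of [2] p. 152, NOT HELD —
acq-09340/07983); this file only removes the `σ²`/(2.33) binder of leaf (a) on the classes where the tree has (2.33).  (ii) Classes
covered: `A = 0`, `Ω = T_ε` (both factors; every level `k < K`, every volume, every conditioning set `Λ`); `A = 0` on the printed
regions `Ω = B^k(Λ_k)`, `Λ ⊆ Λ_k` (scalar factor, `1 ≤ k < K`); (2.23)-regular `A` on `T_ε` for the scalar factor at levels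
`1 ≤ k < K`; `A` regular ON the region `Ω = B^k(Λ_k)`, `Λ ⊆ Λ_k` (scalar factor, `1 ≤ k < K`, `e² ≤ E₀`).  NOT covered: general
(non-regular, e.g. large-field) `A` — no (2.33) there, as in print; the VECTOR factor only at zero field / zero charge / `Ω = T_ε`
(that IS the measure `dμ_{C^{(k)}}(A′)` of (3.24)/(3.59): the gauge-field fluctuation covariance does not depend on a background).
(iii) Constants: `σ₁² = L²/min{a, 8γ₀(d,L,a,m²)}` (zero field), `σ₁² = γ⁻¹` of `ineq233_lower_printed_torus`
(regular field) — ours, immaterial; print's `κ > d` is here `K` arbitrary with the smallness `2n|T|(L^kε)^K ≤ ½` explicit, as in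
r14's file.  (iv) `k < K` strictly (the (2.33) files' range); r14's carrier theorems allow `k ≤ K`.  NOT summit progress; NOT Clay.
-/

open scoped BigOperators InnerProductSpace
open _root_.MeasureTheory _root_.ProbabilityTheory

namespace Literature.MathematicalPhysics.QuantumFieldTheory.Balaban1983to89.B1Eq324SmallFieldLeafModels

open HiggsLattice HiggsAveraging HiggsCovariance HiggsFluctMeasure
open HiggsCovariancePos (siteInner_self_nonneg)
open B1Eq230FluctCov (precOpA precOpA_zero_field)
open B2Prop31ZeroFieldConcrete (gamma0 gamma0_pos)
open B1Ineq233LowerZeroFieldTorus (ineq233_lower_zeroField_all lowConst_pos)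
open B1Ineq233LowerBackgroundTorus (ineq233_lower_printed_torus)
open B1Eq343FluctuationChi (chiFluctA chiFluctφ)
open HiggsCondGauss228 (condGauss fieldOfCrd)
open B1Eq31Concrete (thrF)
open B1Eq324SmallFieldLeaf (bondVar siteVar bondVar_le_of_ineq233_lower' siteVar_le_of_ineq233_lower'
  abs_log_integral_chiFluctA_le abs_log_integral_chiFluctφ_le abs_log_integral_chiFluctA_thrF abs_log_integral_chiFluctφ_thrF
  one_sub_integral_chiFluctA_le one_sub_integral_chiFluctφ_le abs_log_mul_le thrF_sq_div exp_neg_pFn_sq_le_pow)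

noncomputable section

/-! ## §1 The vector factor `χ(A′)` under `dμ_{C^{(j),L^jε}}`: the (2.33) input at zero field BY NAME -/

section Vector

variable {P : HiggsLattice.Params} {j : ℕ}

/-- **The (2.33) lower half FOR THE OPERATOR OF `dμ_{C^{(j),L^jε}}(A′)`**: the (2.30) operator `a(L^{j+1}ε)^{−2}P + Δ^{(j)}` of the
vector fluctuation measure (`HiggsFluctMeasure.precOp`) is `precOpA (zeroCharge d) T_ε 0` (the typer's `precOpA_zero_field`), so
p15/r14's zero-field whole-torus (2.33)ₗ `ineq233_lower_zeroField_all` applies verbatim: for `μ₀² > 0`, `a > 0`, `L > 1`, every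
`j < K` with `L^jε ≤ 1` and EVERY `f`, `(min{a,8γ₀}/L²)(L^jε)^{−2}‖f‖² ≤ ⟨f,(a(L^{j+1}ε)^{−2}P + Δ^{(j),L^jε})f⟩`, `γ₀ = gamma0 P a μ₀²`.
[cite: Balaban1982Higgs1, Prop. 2.3 (2.33) p.611] -/
theorem ineq233_lower_precOp {μ0sq a : ℝ} (hμ : 0 < μ0sq) (ha : 0 < a) (hL : 1 < P.L) (hj : j < P.K)
    (hs : P.mesh j ≤ 1) (f : HiggsLattice.ScalarField P j P.d) :
    min a (8 * gamma0 P a μ0sq) / (P.L : ℝ) ^ 2 * ((P.mesh j)⁻¹ ^ 2) * siteInner f f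
      ≤ siteInner f (precOp P μ0sq a j f) := by
  rw [← precOpA_zero_field]
  exact ineq233_lower_zeroField_all (B3MultiscaleFields.zeroCharge P.d) ha hL hμ hj hs f

/-- **THE VARIANCE BOUND OF THE BOND VARIABLE `A′_b`, HYPOTHESIS-FREE**: `bondVar b ≤ (L²/min{a,8γ₀})·(L^jε)^{−(d−2)}` for every
bond of `T^{(j)}` (`μ₀² > 0`, `a > 0`, `L > 1`, `j < K`, `L^jε ≤ 1`) — r14's `bondVar_le_of_ineq233_lower'` fed with
`ineq233_lower_precOp`. [cite: Balaban1982Higgs1, Prop. 2.3 (2.33) p.611] -/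
theorem bondVar_le_zeroField {μ0sq a : ℝ} (hμ : 0 < μ0sq) (ha : 0 < a) (hL : 1 < P.L) (hj : j < P.K)
    (hs : P.mesh j ≤ 1) (b : HiggsLattice.PBond P j) :
    bondVar P μ0sq a j b ≤ (min a (8 * gamma0 P a μ0sq) / (P.L : ℝ) ^ 2)⁻¹ * P.mesh j ^ (-((P.d : ℝ) - 2)) := by
  have hLr : (1 : ℝ) < (P.L : ℝ) := by exact_mod_cast hL
  exact bondVar_le_of_ineq233_lower' hμ ha hLr hj.le (lowConst_pos ha hL hμ.le)
    (fun f => ineq233_lower_precOp hμ ha hL hj hs f) b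

/-- **LEAF (a) FOR THE VECTOR FACTOR IN THE TREE'S `ε`-UNITS, NO COVARIANCE HYPOTHESIS**: with the threshold
`(L^jε)^{−(d−2)/2}p₁(L^jε)` (`thrF`, `p₁ = B2.pFn b₁ p₁`) and `σ₁² = L²/min{a,8γ₀}`, if `e^{−p₁(L^jε)²/(2dσ₁²)} ≤ (L^jε)^K` and
`2d|T^{(j)}|(L^jε)^K ≤ ½` then `|log⟨χ(A′)⟩| ≤ 4d|T^{(j)}|(L^jε)^K` (`μ₀² > 0`, `a > 0`, `L > 1`, `j < K`, `L^jε ≤ 1`, `b₁ > 0`).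
[cite: Balaban1982Higgs1, (3.24) p.616] -/
theorem abs_log_integral_chiFluctA_thrF_zeroField {μ0sq a : ℝ} (hμ : 0 < μ0sq) (ha : 0 < a) (hL : 1 < P.L) (hj : j < P.K)
    (hs : P.mesh j ≤ 1) {b₁ p₁ : ℝ} (hb : 0 < b₁) {K : ℕ}
    (hexp : Real.exp (-(B2.pFn b₁ p₁ (P.mesh j) ^ 2
        / (2 * P.d * (min a (8 * gamma0 P a μ0sq) / (P.L : ℝ) ^ 2)⁻¹))) ≤ P.mesh j ^ K)
    (hsmall : 2 * P.d * Fintype.card (HiggsLattice.Site P j) * P.mesh j ^ K ≤ 1 / 2) :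
    |Real.log (∫ A, chiFluctA (thrF P.d (P.mesh j) (B2.pFn b₁ p₁ (P.mesh j))) A ∂(fluctMeasure P μ0sq a j))|
      ≤ 4 * P.d * Fintype.card (HiggsLattice.Site P j) * P.mesh j ^ K := by
  have hLr : (1 : ℝ) < (P.L : ℝ) := by exact_mod_cast hL
  exact abs_log_integral_chiFluctA_thrF hμ ha hLr hj.le (inv_pos.mpr (lowConst_pos ha hL hμ.le))
    (bondVar_le_zeroField hμ ha hL hj hs) hb hs hexp hsmall

/-- The tail total in the tree's `ε`-units: with `t = thrF d s p` and `σ² = σ₁²s^{−(d−2)}` the Gaussian exponent is `p²/(2nσ₁²)`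
(r14's `thrF_sq_div`), so `e^{−p²/(2nσ₁²)} ≤ s^K` bounds the tail total `2n·|T|·e^{−t²/(2nσ²)}` by `2n·|T|·s^K`.
[cite: Balaban1982Higgs1, (1.22) p.607] -/
theorem tail_thrF_le {n : ℕ} {s σ1sq p vol : ℝ} (hs : 0 < s) (hvol : 0 ≤ vol) {K : ℕ}
    (hexp : Real.exp (-(p ^ 2 / (2 * n * σ1sq))) ≤ s ^ K) :
    2 * n * vol * Real.exp (-(thrF n s p ^ 2 / (2 * n * (σ1sq * s ^ (-((n : ℝ) - 2)))))) ≤ 2 * n * vol * s ^ K := by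
  rw [thrF_sq_div n n hs p σ1sq]
  exact mul_le_mul_of_nonneg_left hexp (by positivity)

/-- `⟨χ(A′)⟩ > 0` (indeed `≥ ½`) for the vector factor at the `thrF` threshold, hypothesis-free but for the two smallness conditions
of `abs_log_integral_chiFluctA_thrF_zeroField` — the `hpos` slot of p27's `eq324_chi` for the model. [cite: Balaban1982Higgs1, (3.24) p.616] -/
theorem integral_chiFluctA_thrF_pos_zeroField {μ0sq a : ℝ} (hμ : 0 < μ0sq) (ha : 0 < a) (hL : 1 < P.L) (hj : j < P.K)
    (hs : P.mesh j ≤ 1) {b₁ p₁ : ℝ} (hb : 0 < b₁) {K : ℕ}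
    (hexp : Real.exp (-(B2.pFn b₁ p₁ (P.mesh j) ^ 2
        / (2 * P.d * (min a (8 * gamma0 P a μ0sq) / (P.L : ℝ) ^ 2)⁻¹))) ≤ P.mesh j ^ K)
    (hsmall : 2 * P.d * Fintype.card (HiggsLattice.Site P j) * P.mesh j ^ K ≤ 1 / 2) :
    0 < ∫ A, chiFluctA (thrF P.d (P.mesh j) (B2.pFn b₁ p₁ (P.mesh j))) A ∂(fluctMeasure P μ0sq a j) := by
  have hLr : (1 : ℝ) < (P.L : ℝ) := by exact_mod_cast hL
  have hm : 0 < P.mesh j := P.mesh_pos j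
  have hσ0 : 0 < (min a (8 * gamma0 P a μ0sq) / (P.L : ℝ) ^ 2)⁻¹ := inv_pos.mpr (lowConst_pos ha hL hμ.le)
  have hσ0' : 0 < (min a (8 * gamma0 P a μ0sq) / (P.L : ℝ) ^ 2)⁻¹ * P.mesh j ^ (-((P.d : ℝ) - 2)) :=
    mul_pos hσ0 (Real.rpow_pos_of_pos hm _)
  have ht : 0 ≤ thrF P.d (P.mesh j) (B2.pFn b₁ p₁ (P.mesh j)) := by
    unfold thrF
    exact mul_nonneg (Real.rpow_nonneg hm.le _) (B1Ineq353Proof.pFn_nonneg hb.le hm hs)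
  have h1 := one_sub_integral_chiFluctA_le (P := P) hμ ha hLr hj.le hσ0' (bondVar_le_zeroField hμ ha hL hj hs) ht
  have h2 := tail_thrF_le (n := P.d) (σ1sq := (min a (8 * gamma0 P a μ0sq) / (P.L : ℝ) ^ 2)⁻¹)
    (p := B2.pFn b₁ p₁ (P.mesh j)) hm (Nat.cast_nonneg (Fintype.card (HiggsLattice.Site P j))) hexp
  linarith

/-- **LEAF (a) FOR THE VECTOR FACTOR, PRINTED FORM, NO COVARIANCE HYPOTHESIS**: for `d ≥ 1`, `L > 1`, `a, μ₀² > 0`, `b₁ > 0`,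
`p₁ > ½` and every `K` there is `s₁ > 0` — a function of `(d, L, a, μ₀², b₁, p₁, K)` only — such that for EVERY torus of the family
with parameters `(d, L)`, every level `j < K_P` with `L^jε ≤ s₁` and `2d|T^{(j)}|(L^jε)^K ≤ ½`:
`|log⟨χ(A′)⟩| ≤ 4d|T^{(j)}|(L^jε)^K` and `⟨χ(A′)⟩ > 0` — print's *"O(ε^κ)|T₁|"* (`κ = K` arbitrary) for the vector factor of (3.24)/(3.59).
[cite: Balaban1982Higgs1, (3.24) p.616] -/
theorem abs_log_integral_chiFluctA_zeroField_printed (d L : ℕ) (hd : 0 < d) (hL : 1 < L) {a μ0sq : ℝ} (ha : 0 < a)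
    (hμ : 0 < μ0sq) {b₁ p₁ : ℝ} (hb : 0 < b₁) (hp : 1 / 2 < p₁) (K : ℕ) :
    ∃ s₁ : ℝ, 0 < s₁ ∧ ∀ (P : HiggsLattice.Params), P.d = d → P.L = L →
      ∀ {j : ℕ}, j < P.K → P.mesh j ≤ s₁ →
        2 * P.d * Fintype.card (HiggsLattice.Site P j) * P.mesh j ^ K ≤ 1 / 2 →
          |Real.log (∫ A, chiFluctA (thrF P.d (P.mesh j) (B2.pFn b₁ p₁ (P.mesh j))) A ∂(fluctMeasure P μ0sq a j))|
              ≤ 4 * P.d * Fintype.card (HiggsLattice.Site P j) * P.mesh j ^ K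
          ∧ 0 < ∫ A, chiFluctA (thrF P.d (P.mesh j) (B2.pFn b₁ p₁ (P.mesh j))) A ∂(fluctMeasure P μ0sq a j) := by
  -- the scale-free variance constant of the `(d, L)` family, written without `P`
  obtain ⟨σ, hσ⟩ : ∃ σ : ℝ, σ = (min a (8 * (min (a * (1 - (((L : ℕ) : ℝ) ^ 2)⁻¹) / (8 * ((d : ℕ) : ℝ) + 2 * μ0sq)) (1 / 4)))
      / ((L : ℕ) : ℝ) ^ 2)⁻¹ := ⟨_, rfl⟩
  have hLr : (1 : ℝ) < ((L : ℕ) : ℝ) := by exact_mod_cast hL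
  have hγ : 0 < min (a * (1 - (((L : ℕ) : ℝ) ^ 2)⁻¹) / (8 * ((d : ℕ) : ℝ) + 2 * μ0sq)) (1 / 4) := by
    have h1 : 0 < 1 - (((L : ℕ) : ℝ) ^ 2)⁻¹ := by
      have : (1 : ℝ) < ((L : ℕ) : ℝ) ^ 2 := by nlinarith
      have : (((L : ℕ) : ℝ) ^ 2)⁻¹ < 1 := inv_lt_one_of_one_lt₀ this
      linarith
    have hd' : (0 : ℝ) ≤ ((d : ℕ) : ℝ) := Nat.cast_nonneg d
    exact lt_min (div_pos (mul_pos ha h1) (by linarith)) (by norm_num)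
  have hσpos : 0 < σ := by
    rw [hσ]
    exact inv_pos.mpr (div_pos (lt_min ha (by linarith)) (by positivity))
  obtain ⟨s₁, hs₁, h⟩ := exp_neg_pFn_sq_le_pow hd hσpos hb hp K
  refine ⟨min s₁ 1, lt_min hs₁ one_pos, fun P hPd hPL j hj hs hsmall => ?_⟩
  subst hPd hPL
  have hm : 0 < P.mesh j := P.mesh_pos j
  have hs1 : P.mesh j ≤ 1 := hs.trans (min_le_right _ _)
  have he := h (P.mesh j) hm (hs.trans (min_le_left _ _))
  have hσP : σ = (min a (8 * gamma0 P a μ0sq) / (P.L : ℝ) ^ 2)⁻¹ := by rw [hσ]; rfl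
  rw [hσP] at he
  exact ⟨abs_log_integral_chiFluctA_thrF_zeroField hμ ha hL hj hs1 hb he hsmall,
    integral_chiFluctA_thrF_pos_zeroField hμ ha hL hj hs1 hb he hsmall⟩

end Vector

/-! ## §2 The scalar factor `χ(φ′)` under `dμ_{C^{(k)}_Λ(T_ε,0)}`: the (2.33) input at zero field BY NAME -/

section Scalar

variable {P : HiggsLattice.Params} {N k : ℕ} (C : ChargeData N)

/-- **THE VARIANCE BOUND OF `φ′(y)_i` AT ZERO BACKGROUND, HYPOTHESIS-FREE**: under `dμ_{C^{(k)}_Λ(T_ε,0)}` (any charge data, any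
`N`, EVERY conditioning set `Λ`), `siteVar y i ≤ (L²/min{a,8γ₀})·(L^kε)^{−(d−2)}` (`m² > 0`, `a > 0`, `L > 1`, `k < K`, `L^kε ≤ 1`;
`γ₀ = gamma0 P a m²`) — r14's `siteVar_le_of_ineq233_lower'` fed with `ineq233_lower_zeroField_all`.
[cite: Balaban1982Higgs1, Prop. 2.3 (2.33) p.611] -/
theorem siteVar_le_zeroField {msq a : ℝ} (hmsq : 0 < msq) (ha : 0 < a) (hL : 1 < P.L) (hk : k < P.K)
    (hs : P.mesh k ≤ 1) (Λ : Finset (HiggsLattice.Site P k)) (y : HiggsLattice.Site P k) (i : Fin N) :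
    siteVar P C Finset.univ (0 : HiggsLattice.VecField P 0) msq a k Λ y i
      ≤ (min a (8 * gamma0 P a msq) / (P.L : ℝ) ^ 2)⁻¹ * P.mesh k ^ (-((P.d : ℝ) - 2)) := by
  have hLr : (1 : ℝ) < (P.L : ℝ) := by exact_mod_cast hL
  exact siteVar_le_of_ineq233_lower' C Finset.univ 0 hmsq ha hLr hk.le Λ (lowConst_pos ha hL hmsq.le)
    (fun f => ineq233_lower_zeroField_all C ha hL hmsq hk hs f) y i

/-- **LEAF (a) FOR THE SCALAR FACTOR AT ZERO BACKGROUND IN THE TREE'S `ε`-UNITS, NO COVARIANCE HYPOTHESIS**: with `σ₁² =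
L²/min{a,8γ₀}`, if `e^{−p₁(L^kε)²/(2Nσ₁²)} ≤ (L^kε)^K` and `2N|T^{(k)}|(L^kε)^K ≤ ½` then `|log⟨χ(φ′)⟩| ≤ 4N|T^{(k)}|(L^kε)^K`
under `dμ_{C^{(k)}_Λ(T_ε,0)}`, for EVERY `Λ` (`m² > 0`, `a > 0`, `L > 1`, `k < K`, `L^kε ≤ 1`, `N ≥ 1`, `b₁ > 0`).
[cite: Balaban1982Higgs1, (3.59) p.623] -/
theorem abs_log_integral_chiFluctφ_thrF_zeroField {msq a : ℝ} (hmsq : 0 < msq) (ha : 0 < a) (hL : 1 < P.L) (hk : k < P.K)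
    (hs : P.mesh k ≤ 1) (Λ : Finset (HiggsLattice.Site P k)) (hN : 0 < N) {b₁ p₁ : ℝ} (hb : 0 < b₁) {K : ℕ}
    (hexp : Real.exp (-(B2.pFn b₁ p₁ (P.mesh k) ^ 2
        / (2 * N * (min a (8 * gamma0 P a msq) / (P.L : ℝ) ^ 2)⁻¹))) ≤ P.mesh k ^ K)
    (hsmall : 2 * N * Fintype.card (HiggsLattice.Site P k) * P.mesh k ^ K ≤ 1 / 2) :
    |Real.log (∫ x, chiFluctφ (thrF P.d (P.mesh k) (B2.pFn b₁ p₁ (P.mesh k))) (fieldOfCrd Λ x)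
        ∂(condGauss C Finset.univ (0 : HiggsLattice.VecField P 0) msq a k Λ))|
      ≤ 4 * N * Fintype.card (HiggsLattice.Site P k) * P.mesh k ^ K := by
  have hLr : (1 : ℝ) < (P.L : ℝ) := by exact_mod_cast hL
  exact abs_log_integral_chiFluctφ_thrF C Finset.univ 0 hmsq ha hLr hk.le Λ hN
    (inv_pos.mpr (lowConst_pos ha hL hmsq.le)) (siteVar_le_zeroField C hmsq ha hL hk hs Λ) hb hs hexp hsmall

/-- `⟨χ(φ′)⟩ > 0` for the scalar factor at zero background at the `thrF` threshold (the `hpos` slot). [cite: Balaban1982Higgs1, (3.59) p.623] -/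
theorem integral_chiFluctφ_thrF_pos_zeroField {msq a : ℝ} (hmsq : 0 < msq) (ha : 0 < a) (hL : 1 < P.L) (hk : k < P.K)
    (hs : P.mesh k ≤ 1) (Λ : Finset (HiggsLattice.Site P k)) (hN : 0 < N) {b₁ p₁ : ℝ} (hb : 0 < b₁) {K : ℕ}
    (hexp : Real.exp (-(B2.pFn b₁ p₁ (P.mesh k) ^ 2
        / (2 * N * (min a (8 * gamma0 P a msq) / (P.L : ℝ) ^ 2)⁻¹))) ≤ P.mesh k ^ K)
    (hsmall : 2 * N * Fintype.card (HiggsLattice.Site P k) * P.mesh k ^ K ≤ 1 / 2) :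
    0 < ∫ x, chiFluctφ (thrF P.d (P.mesh k) (B2.pFn b₁ p₁ (P.mesh k))) (fieldOfCrd Λ x)
        ∂(condGauss C Finset.univ (0 : HiggsLattice.VecField P 0) msq a k Λ) := by
  have hLr : (1 : ℝ) < (P.L : ℝ) := by exact_mod_cast hL
  have hm : 0 < P.mesh k := P.mesh_pos k
  have hσ0 : 0 < (min a (8 * gamma0 P a msq) / (P.L : ℝ) ^ 2)⁻¹ := inv_pos.mpr (lowConst_pos ha hL hmsq.le)
  have hσ0' : 0 < (min a (8 * gamma0 P a msq) / (P.L : ℝ) ^ 2)⁻¹ * P.mesh k ^ (-((P.d : ℝ) - 2)) :=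
    mul_pos hσ0 (Real.rpow_pos_of_pos hm _)
  have ht : 0 ≤ thrF P.d (P.mesh k) (B2.pFn b₁ p₁ (P.mesh k)) := by
    unfold thrF
    exact mul_nonneg (Real.rpow_nonneg hm.le _) (B1Ineq353Proof.pFn_nonneg hb.le hm hs)
  have h1 := one_sub_integral_chiFluctφ_le C Finset.univ 0 hmsq ha hLr hk.le Λ hN hσ0'
    (siteVar_le_zeroField C hmsq ha hL hk hs Λ) ht
  have h2 := tail_thrF_le (n := N) (σ1sq := (min a (8 * gamma0 P a msq) / (P.L : ℝ) ^ 2)⁻¹)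
    (p := B2.pFn b₁ p₁ (P.mesh k)) hm (Nat.cast_nonneg (Fintype.card (HiggsLattice.Site P k))) hexp
  have hkey : thrF N (P.mesh k) (B2.pFn b₁ p₁ (P.mesh k)) ^ 2
        / (2 * N * ((min a (8 * gamma0 P a msq) / (P.L : ℝ) ^ 2)⁻¹ * P.mesh k ^ (-((N : ℝ) - 2))))
      = thrF P.d (P.mesh k) (B2.pFn b₁ p₁ (P.mesh k)) ^ 2
        / (2 * N * ((min a (8 * gamma0 P a msq) / (P.L : ℝ) ^ 2)⁻¹ * P.mesh k ^ (-((P.d : ℝ) - 2)))) := by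
    rw [thrF_sq_div N N hm, thrF_sq_div P.d N hm]
  rw [hkey] at h2
  linarith

/-- **LEAF (a) FOR THE SCALAR FACTOR AT ZERO BACKGROUND, PRINTED FORM, NO COVARIANCE HYPOTHESIS**: for `d ≥ 1`, `L > 1`,
`a, m² > 0`, `N ≥ 1`, `b₁ > 0`, `p₁ > ½` and every `K` there is `s₁ > 0` (a function of `(d, L, a, m², N, b₁, p₁, K)` only) such that
for EVERY torus of the family with parameters `(d, L)`, every charge data, every level `k < K_P` with `L^kε ≤ s₁`, EVERY conditioning
set `Λ` and `2N|T^{(k)}|(L^kε)^K ≤ ½`: `|log⟨χ(φ′)⟩| ≤ 4N|T^{(k)}|(L^kε)^K` and `⟨χ(φ′)⟩ > 0` under `dμ_{C^{(k)}_Λ(T_ε,0)}`.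
[cite: Balaban1982Higgs1, (3.59) p.623] -/
theorem abs_log_integral_chiFluctφ_zeroField_printed (d L : ℕ) (hL : 1 < L) {a msq : ℝ} (ha : 0 < a)
    (hmsq : 0 < msq) (hN : 0 < N) {b₁ p₁ : ℝ} (hb : 0 < b₁) (hp : 1 / 2 < p₁) (K : ℕ) :
    ∃ s₁ : ℝ, 0 < s₁ ∧ ∀ (P : HiggsLattice.Params), P.d = d → P.L = L → ∀ (C : ChargeData N),
      ∀ {k : ℕ}, k < P.K → P.mesh k ≤ s₁ → ∀ Λ : Finset (HiggsLattice.Site P k),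
        2 * N * Fintype.card (HiggsLattice.Site P k) * P.mesh k ^ K ≤ 1 / 2 →
          |Real.log (∫ x, chiFluctφ (thrF P.d (P.mesh k) (B2.pFn b₁ p₁ (P.mesh k))) (fieldOfCrd Λ x)
              ∂(condGauss C Finset.univ (0 : HiggsLattice.VecField P 0) msq a k Λ))|
              ≤ 4 * N * Fintype.card (HiggsLattice.Site P k) * P.mesh k ^ K
          ∧ 0 < ∫ x, chiFluctφ (thrF P.d (P.mesh k) (B2.pFn b₁ p₁ (P.mesh k))) (fieldOfCrd Λ x)
              ∂(condGauss C Finset.univ (0 : HiggsLattice.VecField P 0) msq a k Λ) := by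
  obtain ⟨σ, hσ⟩ : ∃ σ : ℝ, σ = (min a (8 * (min (a * (1 - (((L : ℕ) : ℝ) ^ 2)⁻¹) / (8 * ((d : ℕ) : ℝ) + 2 * msq)) (1 / 4)))
      / ((L : ℕ) : ℝ) ^ 2)⁻¹ := ⟨_, rfl⟩
  have hLr : (1 : ℝ) < ((L : ℕ) : ℝ) := by exact_mod_cast hL
  have hγ : 0 < min (a * (1 - (((L : ℕ) : ℝ) ^ 2)⁻¹) / (8 * ((d : ℕ) : ℝ) + 2 * msq)) (1 / 4) := by
    have h1 : 0 < 1 - (((L : ℕ) : ℝ) ^ 2)⁻¹ := by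
      have : (1 : ℝ) < ((L : ℕ) : ℝ) ^ 2 := by nlinarith
      have : (((L : ℕ) : ℝ) ^ 2)⁻¹ < 1 := inv_lt_one_of_one_lt₀ this
      linarith
    have hd' : (0 : ℝ) ≤ ((d : ℕ) : ℝ) := Nat.cast_nonneg d
    exact lt_min (div_pos (mul_pos ha h1) (by linarith)) (by norm_num)
  have hσpos : 0 < σ := by
    rw [hσ]
    exact inv_pos.mpr (div_pos (lt_min ha (by linarith)) (by positivity))
  obtain ⟨s₁, hs₁, h⟩ := exp_neg_pFn_sq_le_pow hN hσpos hb hp K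
  refine ⟨min s₁ 1, lt_min hs₁ one_pos, fun P hPd hPL C k hk hs Λ hsmall => ?_⟩
  subst hPd hPL
  have hm : 0 < P.mesh k := P.mesh_pos k
  have hs1 : P.mesh k ≤ 1 := hs.trans (min_le_right _ _)
  have he := h (P.mesh k) hm (hs.trans (min_le_left _ _))
  have hσP : σ = (min a (8 * gamma0 P a msq) / (P.L : ℝ) ^ 2)⁻¹ := by rw [hσ]; rfl
  rw [hσP] at he
  exact ⟨abs_log_integral_chiFluctφ_thrF_zeroField C hmsq ha hL hk hs1 Λ hN hb he hsmall,
    integral_chiFluctφ_thrF_pos_zeroField C hmsq ha hL hk hs1 Λ hN hb he hsmall⟩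

end Scalar

/-! ## §3 The product measure of (3.24)/(3.59) at zero background: leaf (a) with nothing assumed beyond the smallness of `L^kε` -/

section Product

variable {P : HiggsLattice.Params} {N k : ℕ} (C : ChargeData N)

/-- **LEAF (a) OF (3.24)/(3.59) FOR THE FULL GAUSSIAN MEASURE `dμ_{C^{(k)}}(A′)dμ_{C^{(k)}_Λ(T_ε,0)}(φ′)` AT ZERO BACKGROUND, IN THE
TREE'S `ε`-UNITS, NO COVARIANCE HYPOTHESIS**: with `σ_A² = L²/min{a,8γ₀(μ₀²)}`, `σ_φ² = L²/min{a,8γ₀(m²)}` and the two scale-free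
smallness conditions `e^{−p₁(L^kε)²/(2dσ_A²)} ≤ (L^kε)^K`, `e^{−p₁(L^kε)²/(2Nσ_φ²)} ≤ (L^kε)^K`, if both tail totals
`2d|T^{(k)}|(L^kε)^K`, `2N|T^{(k)}|(L^kε)^K` are `≤ ½` then `|log(⟨χ(A′)⟩⟨χ(φ′)⟩)| ≤ 4d|T^{(k)}|(L^kε)^K + 4N|T^{(k)}|(L^kε)^K`
(`μ₀², m² > 0`, `a > 0`, `L > 1`, `k < K`, `L^kε ≤ 1`, `N ≥ 1`, `b₁ > 0`; every `Λ`). [cite: Balaban1982Higgs1, (3.59) p.623] -/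
theorem abs_log_integral_chi_prod_thrF_zeroField {μ0sq msq a : ℝ} (hμ : 0 < μ0sq) (hmsq : 0 < msq) (ha : 0 < a)
    (hL : 1 < P.L) (hk : k < P.K) (hs : P.mesh k ≤ 1) (Λ : Finset (HiggsLattice.Site P k)) (hN : 0 < N)
    {b₁ p₁ : ℝ} (hb : 0 < b₁) {K : ℕ}
    (hexpA : Real.exp (-(B2.pFn b₁ p₁ (P.mesh k) ^ 2
        / (2 * P.d * (min a (8 * gamma0 P a μ0sq) / (P.L : ℝ) ^ 2)⁻¹))) ≤ P.mesh k ^ K)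
    (hexpφ : Real.exp (-(B2.pFn b₁ p₁ (P.mesh k) ^ 2
        / (2 * N * (min a (8 * gamma0 P a msq) / (P.L : ℝ) ^ 2)⁻¹))) ≤ P.mesh k ^ K)
    (hsmallA : 2 * P.d * Fintype.card (HiggsLattice.Site P k) * P.mesh k ^ K ≤ 1 / 2)
    (hsmallφ : 2 * N * Fintype.card (HiggsLattice.Site P k) * P.mesh k ^ K ≤ 1 / 2) :
    |Real.log ((∫ A', chiFluctA (thrF P.d (P.mesh k) (B2.pFn b₁ p₁ (P.mesh k))) A' ∂(fluctMeasure P μ0sq a k))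
        * ∫ x, chiFluctφ (thrF P.d (P.mesh k) (B2.pFn b₁ p₁ (P.mesh k))) (fieldOfCrd Λ x)
            ∂(condGauss C Finset.univ (0 : HiggsLattice.VecField P 0) msq a k Λ))|
      ≤ 4 * P.d * Fintype.card (HiggsLattice.Site P k) * P.mesh k ^ K
        + 4 * N * Fintype.card (HiggsLattice.Site P k) * P.mesh k ^ K := by
  have hApos := integral_chiFluctA_thrF_pos_zeroField (P := P) hμ ha hL hk hs hb hexpA hsmallA
  have hφpos := integral_chiFluctφ_thrF_pos_zeroField C hmsq ha hL hk hs Λ hN hb hexpφ hsmallφ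
  exact (abs_log_mul_le hApos hφpos).trans (add_le_add
    (abs_log_integral_chiFluctA_thrF_zeroField (P := P) hμ ha hL hk hs hb hexpA hsmallA)
    (abs_log_integral_chiFluctφ_thrF_zeroField C hmsq ha hL hk hs Λ hN hb hexpφ hsmallφ))

/-- `⟨χ(A′)⟩⟨χ(φ′)⟩ > 0` for the product measure at zero background (the `hpos`/`χ_pos` slot of p27's `eq324_chi`/`Realization`).
[cite: Balaban1982Higgs1, (3.56) p.622] -/
theorem integral_chi_prod_thrF_pos_zeroField {μ0sq msq a : ℝ} (hμ : 0 < μ0sq) (hmsq : 0 < msq) (ha : 0 < a)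
    (hL : 1 < P.L) (hk : k < P.K) (hs : P.mesh k ≤ 1) (Λ : Finset (HiggsLattice.Site P k)) (hN : 0 < N)
    {b₁ p₁ : ℝ} (hb : 0 < b₁) {K : ℕ}
    (hexpA : Real.exp (-(B2.pFn b₁ p₁ (P.mesh k) ^ 2
        / (2 * P.d * (min a (8 * gamma0 P a μ0sq) / (P.L : ℝ) ^ 2)⁻¹))) ≤ P.mesh k ^ K)
    (hexpφ : Real.exp (-(B2.pFn b₁ p₁ (P.mesh k) ^ 2
        / (2 * N * (min a (8 * gamma0 P a msq) / (P.L : ℝ) ^ 2)⁻¹))) ≤ P.mesh k ^ K)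
    (hsmallA : 2 * P.d * Fintype.card (HiggsLattice.Site P k) * P.mesh k ^ K ≤ 1 / 2)
    (hsmallφ : 2 * N * Fintype.card (HiggsLattice.Site P k) * P.mesh k ^ K ≤ 1 / 2) :
    0 < (∫ A', chiFluctA (thrF P.d (P.mesh k) (B2.pFn b₁ p₁ (P.mesh k))) A' ∂(fluctMeasure P μ0sq a k))
        * ∫ x, chiFluctφ (thrF P.d (P.mesh k) (B2.pFn b₁ p₁ (P.mesh k))) (fieldOfCrd Λ x)
            ∂(condGauss C Finset.univ (0 : HiggsLattice.VecField P 0) msq a k Λ) :=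
  mul_pos (integral_chiFluctA_thrF_pos_zeroField (P := P) hμ ha hL hk hs hb hexpA hsmallA)
    (integral_chiFluctφ_thrF_pos_zeroField C hmsq ha hL hk hs Λ hN hb hexpφ hsmallφ)

/-- **LEAF (a) OF (3.24)/(3.59) FOR THE MODEL INSTANCE OF RECORD (zero background, `Ω = T_ε`), PRINTED FORM — p27's `ha` and `hpos`
WITH NO COVARIANCE HYPOTHESIS**: for `d ≥ 1`, `L > 1`, `a, μ₀², m² > 0`, `N ≥ 1`, `b₁ > 0`, `p₁ > ½` and every `K` there is `s₁ > 0`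
(a function of these numbers only) such that for EVERY torus of the family with parameters `(d, L)`, every charge data, every level
`k < K_P` with `L^kε ≤ s₁`, every conditioning set `Λ`, and both tail totals `≤ ½`:
`|log(⟨χ(A′)⟩⟨χ(φ′)⟩)| ≤ 4(d + N)·|T^{(k)}|·(L^kε)^K` and `⟨χ(A′)⟩⟨χ(φ′)⟩ > 0` — print's `O(1)(L^kε)^κ|T₁^{(k)}|` with `κ = K` arbitrary,
i.e. the hypotheses `ha : |log ∫χ dμ| ≤ C₁·s^κ·vol` (`C₁ = 4(d+N)`) and `hpos` of `B1Eq324CumulantTaylor.eq324_chi` on the model.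
[cite: Balaban1982Higgs1, (3.24) p.616; (3.59) p.623] -/
theorem abs_log_integral_chi_prod_zeroField_printed (d L : ℕ) (hd : 0 < d) (hL : 1 < L) {a μ0sq msq : ℝ} (ha : 0 < a)
    (hμ : 0 < μ0sq) (hmsq : 0 < msq) (hN : 0 < N) {b₁ p₁ : ℝ} (hb : 0 < b₁) (hp : 1 / 2 < p₁) (K : ℕ) :
    ∃ s₁ : ℝ, 0 < s₁ ∧ ∀ (P : HiggsLattice.Params), P.d = d → P.L = L → ∀ (C : ChargeData N),
      ∀ {k : ℕ}, k < P.K → P.mesh k ≤ s₁ → ∀ Λ : Finset (HiggsLattice.Site P k),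
        2 * P.d * Fintype.card (HiggsLattice.Site P k) * P.mesh k ^ K ≤ 1 / 2 →
        2 * N * Fintype.card (HiggsLattice.Site P k) * P.mesh k ^ K ≤ 1 / 2 →
          |Real.log ((∫ A', chiFluctA (thrF P.d (P.mesh k) (B2.pFn b₁ p₁ (P.mesh k))) A' ∂(fluctMeasure P μ0sq a k))
              * ∫ x, chiFluctφ (thrF P.d (P.mesh k) (B2.pFn b₁ p₁ (P.mesh k))) (fieldOfCrd Λ x)
                  ∂(condGauss C Finset.univ (0 : HiggsLattice.VecField P 0) msq a k Λ))|
              ≤ 4 * (P.d + N) * Fintype.card (HiggsLattice.Site P k) * P.mesh k ^ K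
          ∧ 0 < (∫ A', chiFluctA (thrF P.d (P.mesh k) (B2.pFn b₁ p₁ (P.mesh k))) A' ∂(fluctMeasure P μ0sq a k))
              * ∫ x, chiFluctφ (thrF P.d (P.mesh k) (B2.pFn b₁ p₁ (P.mesh k))) (fieldOfCrd Λ x)
                  ∂(condGauss C Finset.univ (0 : HiggsLattice.VecField P 0) msq a k Λ) := by
  obtain ⟨sA, hsA, hA⟩ := abs_log_integral_chiFluctA_zeroField_printed d L hd hL ha hμ hb hp K
  obtain ⟨sφ, hsφ, hφ⟩ := abs_log_integral_chiFluctφ_zeroField_printed (N := N) d L hL ha hmsq hN hb hp K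
  refine ⟨min sA sφ, lt_min hsA hsφ, fun P hPd hPL C k hk hs Λ hsmallA hsmallφ => ?_⟩
  obtain ⟨hA1, hA2⟩ := hA P hPd hPL hk (hs.trans (min_le_left _ _)) hsmallA
  obtain ⟨hφ1, hφ2⟩ := hφ P hPd hPL C hk (hs.trans (min_le_right _ _)) Λ hsmallφ
  refine ⟨(abs_log_mul_le hA2 hφ2).trans ?_, mul_pos hA2 hφ2⟩
  have h := add_le_add hA1 hφ1
  refine h.trans (le_of_eq ?_)
  ring

end Product

/-! ## §4 The scalar factor at a (2.23)-regular background field `A` on `T_ε`: the (2.33) input BY NAME from `ineq233_lower_printed_torus` -/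

section Regular

/-- **THE VARIANCE BOUND OF `φ′(y)_i` AT A (2.23)-REGULAR BACKGROUND ON THE WHOLE TORUS**: for `d`, `L > 1`, `a, m² > 0`, a
regularity constant `c` and `N` there are `E₀ > 0` and `σ₁² > 0` (functions of `(d, L, a, m², c)` only) such that for every charge
data with `e² ≤ E₀`, every torus of the family with parameters `(d, L)`, every level `1 ≦ k = j+1 < K_P` with `L^kε ≦ 1` and at least
two `(k+1)`-sites per direction, every `A` `δ`-regular on `T_ε` with `L^k·δ ≦ c·|e|`, EVERY conditioning set `Λ`, site and component:
`siteVar y i ≤ σ₁²·(L^kε)^{−(d−2)}` under `dμ_{C^{(k)}_Λ(T_ε,A)}` — r14's `siteVar_le_of_ineq233_lower'` fed with r14's (2.33)ₗ at regular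
backgrounds `ineq233_lower_printed_torus` (`σ₁² = γ⁻¹`). [cite: Balaban1982Higgs1, Prop. 2.3 (2.33) p.611, Prop. 2.1 (2.23) p.610] -/
theorem siteVar_le_regular_torus (d L : ℕ) (hL1 : 1 < L) {a msq : ℝ} (ha : 0 < a) (hmsq : 0 < msq) (c : ℝ) (N : ℕ) :
    ∃ E₀ : ℝ, 0 < E₀ ∧ ∃ σ1sq : ℝ, 0 < σ1sq ∧
      ∀ (C : ChargeData N), C.e ^ 2 ≤ E₀ →
      ∀ (P : HiggsLattice.Params), P.d = d → P.L = L →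
      ∀ {j : ℕ}, j + 1 < P.K → (∀ μ, 2 ≤ P.sitesPerDir (j + 1 + 1) μ) → P.mesh (j + 1) ≤ 1 →
      ∀ (A : HiggsLattice.VecField P 0) {δ : ℝ}, 0 ≤ δ →
        (∀ (z : HiggsLattice.Site P 0) (μ' ν : Fin P.d), |A ⟨z.shift ν, μ'⟩ - A ⟨z, μ'⟩| ≤ δ) →
        (P.L : ℝ) ^ (j + 1) * δ ≤ c * |C.e| →
        ∀ (Λ : Finset (HiggsLattice.Site P (j + 1))) (y : HiggsLattice.Site P (j + 1)) (i : Fin N),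
          siteVar P C Finset.univ A msq a (j + 1) Λ y i ≤ σ1sq * P.mesh (j + 1) ^ (-((P.d : ℝ) - 2)) := by
  obtain ⟨E₀, hE₀, γ, hγ, h⟩ := ineq233_lower_printed_torus d L hL1 ha hmsq c N
  refine ⟨E₀, hE₀, γ⁻¹, inv_pos.mpr hγ, fun C heE P hPd hPL j hjK hN2 hs A δ hδ hreg hu Λ y i => ?_⟩
  have hLr : (1 : ℝ) < (P.L : ℝ) := by rw [hPL]; exact_mod_cast hL1
  exact siteVar_le_of_ineq233_lower' C Finset.univ A hmsq ha hLr hjK.le Λ hγ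
    (fun f => h C heE P hPd hPL hjK hN2 hs A hδ hreg hu f) y i

/-- **LEAF (a) FOR THE SCALAR FACTOR AT A (2.23)-REGULAR BACKGROUND, PRINTED FORM**: for `d ≥ 1`, `L > 1`, `a, m² > 0`, `c`,
`N ≥ 1`, `b₁ > 0`, `p₁ > ½` and every `K` there are `E₀ > 0` and `s₁ > 0` (functions of these numbers only) such that for every
charge data with `e² ≤ E₀`, every torus of the family with parameters `(d, L)`, every level `1 ≦ k = j+1 < K_P` with at least two
`(k+1)`-sites per direction and `L^kε ≤ s₁`, every `A` `δ`-regular on `T_ε` with `L^kδ ≦ c|e|`, EVERY conditioning set `Λ`, and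
`2N|T^{(k)}|(L^kε)^K ≤ ½`: `|log⟨χ(φ′)⟩| ≤ 4N|T^{(k)}|(L^kε)^K` under `dμ_{C^{(k)}_Λ(T_ε,A)}` — the (3.59) leaf (a) for the scalar factor
at the regular backgrounds of Prop. 2.1, no covariance hypothesis left. [cite: Balaban1982Higgs1, (3.59) p.623, Prop. 2.1 (2.23) p.610] -/
theorem abs_log_integral_chiFluctφ_regular_printed (d L : ℕ) (hL1 : 1 < L) {a msq : ℝ} (ha : 0 < a) (hmsq : 0 < msq)
    (c : ℝ) {N : ℕ} (hN : 0 < N) {b₁ p₁ : ℝ} (hb : 0 < b₁) (hp : 1 / 2 < p₁) (K : ℕ) :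
    ∃ E₀ : ℝ, 0 < E₀ ∧ ∃ s₁ : ℝ, 0 < s₁ ∧
      ∀ (C : ChargeData N), C.e ^ 2 ≤ E₀ →
      ∀ (P : HiggsLattice.Params), P.d = d → P.L = L →
      ∀ {j : ℕ}, j + 1 < P.K → (∀ μ, 2 ≤ P.sitesPerDir (j + 1 + 1) μ) → P.mesh (j + 1) ≤ s₁ →
      ∀ (A : HiggsLattice.VecField P 0) {δ : ℝ}, 0 ≤ δ →
        (∀ (z : HiggsLattice.Site P 0) (μ' ν : Fin P.d), |A ⟨z.shift ν, μ'⟩ - A ⟨z, μ'⟩| ≤ δ) →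
        (P.L : ℝ) ^ (j + 1) * δ ≤ c * |C.e| →
        ∀ (Λ : Finset (HiggsLattice.Site P (j + 1))),
          2 * N * Fintype.card (HiggsLattice.Site P (j + 1)) * P.mesh (j + 1) ^ K ≤ 1 / 2 →
          |Real.log (∫ x, chiFluctφ (thrF P.d (P.mesh (j + 1)) (B2.pFn b₁ p₁ (P.mesh (j + 1)))) (fieldOfCrd Λ x)
              ∂(condGauss C Finset.univ A msq a (j + 1) Λ))|
            ≤ 4 * N * Fintype.card (HiggsLattice.Site P (j + 1)) * P.mesh (j + 1) ^ K := by
  obtain ⟨E₀, hE₀, σ1sq, hσ, hvar⟩ := siteVar_le_regular_torus d L hL1 ha hmsq c N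
  obtain ⟨s₁, hs₁, h⟩ := exp_neg_pFn_sq_le_pow hN hσ hb hp K
  refine ⟨E₀, hE₀, min s₁ 1, lt_min hs₁ one_pos, fun C heE P hPd hPL j hjK hN2 hs A δ hδ hreg hu Λ hsmall => ?_⟩
  have hLr : (1 : ℝ) < (P.L : ℝ) := by rw [hPL]; exact_mod_cast hL1
  have hm : 0 < P.mesh (j + 1) := P.mesh_pos _
  have hs1 : P.mesh (j + 1) ≤ 1 := hs.trans (min_le_right _ _)
  have he := h (P.mesh (j + 1)) hm (hs.trans (min_le_left _ _))
  exact abs_log_integral_chiFluctφ_thrF C Finset.univ A hmsq ha hLr hjK.le Λ hN hσ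
    (hvar C heE P hPd hPL hjK hN2 hs1 A hδ hreg hu Λ) hb hs1 he hsmall

end Regular

/-! ## §5 The scalar factor on the printed REGIONS `Ω = B^k(Λ_k)` at zero field: a supported-field variant of r14's §9 -/

section Supported

variable {P : HiggsLattice.Params} {N k : ℕ}
  (C : ChargeData N) (Ω : Finset (HiggsLattice.Site P 0)) (A : HiggsLattice.VecField P 0)

open HiggsCovarianceCont (sNorm)
open HiggsFluctMeasurePos (siteInner_le_sNorm_mul)
open HiggsCondCov232 (condCov232 restrictOp restrictOp_precOpA_condCov232_apply condCov232_apply_of_not_mem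
  siteInner_restrictOp siteInner_cutTo_comm)
open B2Eq255Concrete (cutTo)
open B1Eq324SmallFieldLeaf (cutTo_condCov232 siteDelta siteInner_siteDelta_self)

/-- The Cauchy–Schwarz endgame (as in r14's §9): `c·|f|² ≤ X ≤ |g|·|f|` with `c > 0` forces `X ≤ c⁻¹|g|²`. [folklore] -/
private theorem le_inv_mul_sq_of_coercive {c X sf sg : ℝ} (hc : 0 < c) (hsf : 0 ≤ sf) (hsg : 0 ≤ sg)
    (h1 : c * sf ^ 2 ≤ X) (h2 : X ≤ sg * sf) : X ≤ c⁻¹ * sg ^ 2 := by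
  by_cases h0 : sf = 0
  · rw [h0, mul_zero] at h2
    exact h2.trans (by positivity)
  · have hpos : 0 < sf := lt_of_le_of_ne hsf (Ne.symm h0)
    have h3 : c * sf ≤ sg := by nlinarith
    have h4 : sf ≤ c⁻¹ * sg := by rw [le_inv_mul_iff₀ hc]; exact h3
    nlinarith

/-- **A coercive-ON-SUPPORTED-FIELDS operator has a form-bounded conditional inverse** — the variant of r14's
`siteInner_condCov232_self_le` that the printed regions need: if `c⟨f,f⟩ ≤ ⟨f,(a(L^{k+1}ε)^{−2}P(A) + Δ^{(k)}(Ω,A))f⟩` for all `f`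
SUPPORTED IN a set `S ⊇ Λ` (`c > 0`), then `⟨g, C^{(k)}_Λ(Ω,A)g⟩ ≤ c⁻¹⟨g,g⟩` for every `g` — because `C^{(k)}_Λ g` is itself
supported in `Λ` (p. 611: *"A↾_Λφ = ΛAΛφ"*; `m² > 0`, `a > 0`, `L > 1`, `k ≤ K`). [cite: Balaban1982Higgs1, (2.32) p.611] -/
theorem siteInner_condCov232_self_le_of_supported {msq a : ℝ} (hmsq : 0 < msq) (ha : 0 < a) (hL : 1 < (P.L : ℝ))
    (hk : k ≤ P.K) (S Λ : Finset (HiggsLattice.Site P k)) (hΛS : Λ ⊆ S) {c : ℝ} (hc : 0 < c)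
    (hco : ∀ f : HiggsLattice.ScalarField P k N, (∀ y, y ∉ S → f y = 0) →
      c * siteInner f f ≤ siteInner f (precOpA C Ω A msq a k f))
    (g : HiggsLattice.ScalarField P k N) :
    siteInner g (condCov232 C Ω A msq a k Λ g) ≤ c⁻¹ * siteInner g g := by
  set f := condCov232 C Ω A msq a k Λ g with hf
  have hsupp : cutTo Λ f = f := cutTo_condCov232 C Ω A Λ g
  have hfS : ∀ y, y ∉ S → f y = 0 := fun y hy =>
    condCov232_apply_of_not_mem C Ω A msq a k Λ g (fun h => hy (hΛS h))
  have hR : restrictOp Λ (precOpA C Ω A msq a k) f = cutTo Λ g :=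
    restrictOp_precOpA_condCov232_apply C Ω A hmsq ha hL hk Λ g
  have hX1 : siteInner f (restrictOp Λ (precOpA C Ω A msq a k) f) = siteInner f (precOpA C Ω A msq a k f) := by
    rw [siteInner_restrictOp, hsupp]
  have hX2 : siteInner f (restrictOp Λ (precOpA C Ω A msq a k) f) = siteInner g f := by
    rw [hR, siteInner_cutTo_comm, hsupp]
  have hsf : sNorm f ^ 2 = siteInner f f := Real.sq_sqrt (siteInner_self_nonneg f)
  have hsg : sNorm g ^ 2 = siteInner g g := Real.sq_sqrt (siteInner_self_nonneg g)
  have h1 : c * sNorm f ^ 2 ≤ siteInner g f := by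
    rw [hsf, ← hX2, hX1]
    exact hco f hfS
  have h2 : siteInner g f ≤ sNorm g * sNorm f := siteInner_le_sNorm_mul g f
  have hsf0 : 0 ≤ sNorm f := Real.sqrt_nonneg _
  have hsg0 : 0 ≤ sNorm g := Real.sqrt_nonneg _
  have h := le_inv_mul_sq_of_coercive hc hsf0 hsg0 h1 h2
  rwa [hsg] at h

/-- **THE VARIANCE BOUND FROM A (2.33) LOWER HALF ON SUPPORTED FIELDS**: `γ₀(L^kε)^{−2}‖f‖² ≤ ⟨f,(a(L^{k+1}ε)^{−2}P(A) + Δ^{(k)}(Ω,A))f⟩`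
for the fields `f` supported in `S` gives `siteVar y i ≤ γ₀⁻¹(L^kε)^{−(d−2)}` for every conditioning set `Λ ⊆ S`, site and component
(`m² > 0`, `a > 0`, `L > 1`, `k ≤ K`) — the shape in which the tree's region files state (2.33)ₗ (print p. 611: *"Here we will assume
that the set Λ is a union of big blocks of T₁^{(k)}"*, `Λ ⊂ Ω^{(k)}`). [cite: Balaban1982Higgs1, (2.33) p.611] -/
theorem siteVar_le_of_ineq233_lower_supported {msq a : ℝ} (hmsq : 0 < msq) (ha : 0 < a) (hL : 1 < (P.L : ℝ)) (hk : k ≤ P.K)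
    (S Λ : Finset (HiggsLattice.Site P k)) (hΛS : Λ ⊆ S) {γ₀ : ℝ} (hγ : 0 < γ₀)
    (h233 : ∀ f : HiggsLattice.ScalarField P k N, (∀ y, y ∉ S → f y = 0) →
      γ₀ * (P.mesh k)⁻¹ ^ 2 * siteInner f f ≤ siteInner f (precOpA C Ω A msq a k f))
    (y : HiggsLattice.Site P k) (i : Fin N) :
    siteVar P C Ω A msq a k Λ y i ≤ γ₀⁻¹ * P.mesh k ^ (-((P.d : ℝ) - 2)) := by
  have hs : 0 < P.mesh k := P.mesh_pos k
  have hc : 0 < γ₀ * (P.mesh k)⁻¹ ^ 2 := by positivity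
  have h := siteInner_condCov232_self_le_of_supported C Ω A hmsq ha hL hk S Λ hΛS hc h233 (siteDelta y i)
  rw [siteInner_siteDelta_self] at h
  have hpow : P.mesh k ^ 2 * (P.mesh k ^ P.d)⁻¹ = P.mesh k ^ (-((P.d : ℝ) - 2)) := by
    rw [← Real.rpow_natCast (P.mesh k) P.d, ← Real.rpow_neg hs.le, ← Real.rpow_natCast (P.mesh k) 2,
      ← Real.rpow_add hs]
    congr 1
    push_cast
    ring
  unfold B1Eq324SmallFieldLeaf.siteVar
  refine h.trans (le_of_eq ?_)
  rw [mul_inv, inv_pow, inv_inv, mul_assoc, hpow]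

end Supported

section Region

variable {P : HiggsLattice.Params} {N K : ℕ} (R : B2Eq337ScalarIntegration.Regions P K) (C : ChargeData N)

open B2Eq337ScalarIntegration (Regions V)
open B2Eq328ConcretePieces (LSite pieceF)
open B2Eq328DeltaK (extL)
open HiggsRescaling (IsUnionOfLargeBlocks)
open B1Ineq233LowerZeroFieldRegion (ineq233_lower_zeroField_region ineq233_lower_zeroField_region_largeBlocks)

/-- A field supported in `Λ_k = R.block j` IS the zero extension of its restriction. [cite: Balaban1982Higgs1, (2.32) p.611] -/
theorem extL_restrict_of_supported (j : Fin K) (f : HiggsLattice.ScalarField P (j.val + 1) N)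
    (hf : ∀ y, y ∉ R.block j → f y = 0) : extL R j (fun y : LSite R j => f y.1) = f := by
  funext y
  unfold extL
  by_cases h : y ∈ R.block j
  · rw [dif_pos h]
  · rw [dif_neg h, hf y h]

/-- **(2.33)ₗ AT ZERO FIELD ON THE PRINTED REGIONS, SUPPORTED-FIELD FORM**: for `Ω = B^k(Λ_k)` (`pieceF R j`, `Λ_k = R.block j` a
union of `(k+1)`-blocks, `1 ≦ k = j+1 < K ≦ K_P`, `L^kε ≦ 1`) and every field `f` on `T^{(k)}` supported in `Λ_k`:
`(min{a,8γ₀}/L²)(L^kε)^{−2}‖f‖² ≤ ⟨f,(a(L^{k+1}ε)^{−2}P(0) + Δ^{(k),L^kε}(Ω,0))f⟩` — r14's `ineq233_lower_zeroField_region` (stated for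
zero extensions `ψ̃`) read on supported fields. [cite: Balaban1982Higgs1, Prop. 2.3 (2.33) p.611] -/
theorem ineq233_lower_zeroField_region_supported {a msq : ℝ} (ha : 0 < a) (hL : 1 < P.L) (hmsq : 0 < msq) (hK : K ≤ P.K)
    (j : Fin K) (hjK : j.val + 1 < P.K) (hs : P.mesh (j.val + 1) ≤ 1)
    (hU : ∀ y y' : HiggsLattice.Site P (j.val + 1),
      HiggsLattice.blockOf y = HiggsLattice.blockOf y' → (y ∈ R.block j ↔ y' ∈ R.block j))
    (f : HiggsLattice.ScalarField P (j.val + 1) N) (hf : ∀ y, y ∉ R.block j → f y = 0) :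
    min a (8 * gamma0 P a msq) / (P.L : ℝ) ^ 2 * ((P.mesh (j.val + 1))⁻¹ ^ 2) * siteInner f f
      ≤ siteInner f (precOpA C (pieceF R j) (0 : HiggsLattice.VecField P 0) msq a (j.val + 1) f) := by
  have h := ineq233_lower_zeroField_region R C ha hL hmsq hK j hjK hs hU (fun y : LSite R j => f y.1)
  rwa [extL_restrict_of_supported R j f hf] at h

/-- **THE VARIANCE BOUND OF `φ′(y)_i` UNDER `dμ_{C^{(k)}_Λ(B^k(Λ_k),0)}` ON THE PRINTED REGIONS, HYPOTHESIS-FREE**: for `Λ ⊆ Λ_k`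
(`Λ_k` a union of `(k+1)`-blocks, `1 ≦ k = j+1 < K ≦ K_P`, `L^kε ≦ 1`; `m² > 0`, `a > 0`, `L > 1`):
`siteVar y i ≤ (L²/min{a,8γ₀})(L^kε)^{−(d−2)}`. [cite: Balaban1982Higgs1, Prop. 2.3 (2.33) p.611] -/
theorem siteVar_le_zeroField_region {a msq : ℝ} (ha : 0 < a) (hL : 1 < P.L) (hmsq : 0 < msq) (hK : K ≤ P.K)
    (j : Fin K) (hjK : j.val + 1 < P.K) (hs : P.mesh (j.val + 1) ≤ 1)
    (hU : ∀ y y' : HiggsLattice.Site P (j.val + 1),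
      HiggsLattice.blockOf y = HiggsLattice.blockOf y' → (y ∈ R.block j ↔ y' ∈ R.block j))
    (Λ : Finset (HiggsLattice.Site P (j.val + 1))) (hΛ : Λ ⊆ R.block j)
    (y : HiggsLattice.Site P (j.val + 1)) (i : Fin N) :
    siteVar P C (pieceF R j) (0 : HiggsLattice.VecField P 0) msq a (j.val + 1) Λ y i
      ≤ (min a (8 * gamma0 P a msq) / (P.L : ℝ) ^ 2)⁻¹ * P.mesh (j.val + 1) ^ (-((P.d : ℝ) - 2)) := by
  have hLr : (1 : ℝ) < (P.L : ℝ) := by exact_mod_cast hL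
  exact siteVar_le_of_ineq233_lower_supported C (pieceF R j) 0 hmsq ha hLr hjK.le (R.block j) Λ hΛ
    (lowConst_pos ha hL hmsq.le)
    (fun f hf => ineq233_lower_zeroField_region_supported R C ha hL hmsq hK j hjK hs hU f hf) y i

/-- The same under print's *"sum of big blocks"* hypothesis verbatim (`IsUnionOfLargeBlocks Λ_k`).
[cite: Balaban1982Higgs1, Prop. 2.3 (2.33) p.611; Prop. 2.1 p.610] -/
theorem siteVar_le_zeroField_region_largeBlocks {a msq : ℝ} (ha : 0 < a) (hL : 1 < P.L) (hmsq : 0 < msq) (hK : K ≤ P.K)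
    (j : Fin K) (hjK : j.val + 1 < P.K) (hs : P.mesh (j.val + 1) ≤ 1) (hU : IsUnionOfLargeBlocks (R.block j))
    (Λ : Finset (HiggsLattice.Site P (j.val + 1))) (hΛ : Λ ⊆ R.block j)
    (y : HiggsLattice.Site P (j.val + 1)) (i : Fin N) :
    siteVar P C (pieceF R j) (0 : HiggsLattice.VecField P 0) msq a (j.val + 1) Λ y i
      ≤ (min a (8 * gamma0 P a msq) / (P.L : ℝ) ^ 2)⁻¹ * P.mesh (j.val + 1) ^ (-((P.d : ℝ) - 2)) := by
  have hLr : (1 : ℝ) < (P.L : ℝ) := by exact_mod_cast hL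
  refine siteVar_le_of_ineq233_lower_supported C (pieceF R j) 0 hmsq ha hLr hjK.le (R.block j) Λ hΛ
    (lowConst_pos ha hL hmsq.le) (fun f hf => ?_) y i
  have h := ineq233_lower_zeroField_region_largeBlocks R C ha hL hmsq hK j hjK hs hU (fun y : LSite R j => f y.1)
  rwa [extL_restrict_of_supported R j f hf] at h

/-- **LEAF (a) FOR THE SCALAR FACTOR ON THE PRINTED REGIONS AT ZERO FIELD, IN THE TREE'S `ε`-UNITS, NO COVARIANCE HYPOTHESIS**:
under `dμ_{C^{(k)}_Λ(B^k(Λ_k),0)}` with `Λ ⊆ Λ_k` a union of big blocks (`1 ≦ k = j+1 < K ≦ K_P`, `L^kε ≦ 1`, `N ≥ 1`, `b₁ > 0`),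
`|log⟨χ(φ′)⟩| ≤ 4N|T^{(k)}|(L^kε)^K` and `⟨χ(φ′)⟩ > 0` as soon as `e^{−p₁(L^kε)²/(2Nσ₁²)} ≤ (L^kε)^K` (`σ₁² = L²/min{a,8γ₀}`) and
`2N|T^{(k)}|(L^kε)^K ≤ ½`. [cite: Balaban1982Higgs1, (3.59) p.623; Prop. 2.3 (2.33) p.611] -/
theorem abs_log_integral_chiFluctφ_thrF_zeroField_region {a msq : ℝ} (ha : 0 < a) (hL : 1 < P.L) (hmsq : 0 < msq)
    (hK : K ≤ P.K) (j : Fin K) (hjK : j.val + 1 < P.K) (hs : P.mesh (j.val + 1) ≤ 1) (hU : IsUnionOfLargeBlocks (R.block j))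
    (Λ : Finset (HiggsLattice.Site P (j.val + 1))) (hΛ : Λ ⊆ R.block j) (hN : 0 < N) {b₁ p₁ : ℝ} (hb : 0 < b₁) {K' : ℕ}
    (hexp : Real.exp (-(B2.pFn b₁ p₁ (P.mesh (j.val + 1)) ^ 2
        / (2 * N * (min a (8 * gamma0 P a msq) / (P.L : ℝ) ^ 2)⁻¹))) ≤ P.mesh (j.val + 1) ^ K')
    (hsmall : 2 * N * Fintype.card (HiggsLattice.Site P (j.val + 1)) * P.mesh (j.val + 1) ^ K' ≤ 1 / 2) :
    |Real.log (∫ x, chiFluctφ (thrF P.d (P.mesh (j.val + 1)) (B2.pFn b₁ p₁ (P.mesh (j.val + 1)))) (fieldOfCrd Λ x)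
        ∂(condGauss C (pieceF R j) (0 : HiggsLattice.VecField P 0) msq a (j.val + 1) Λ))|
      ≤ 4 * N * Fintype.card (HiggsLattice.Site P (j.val + 1)) * P.mesh (j.val + 1) ^ K'
    ∧ 0 < ∫ x, chiFluctφ (thrF P.d (P.mesh (j.val + 1)) (B2.pFn b₁ p₁ (P.mesh (j.val + 1)))) (fieldOfCrd Λ x)
        ∂(condGauss C (pieceF R j) (0 : HiggsLattice.VecField P 0) msq a (j.val + 1) Λ) := by
  have hLr : (1 : ℝ) < (P.L : ℝ) := by exact_mod_cast hL
  have hm : 0 < P.mesh (j.val + 1) := P.mesh_pos _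
  have hσ0 : 0 < (min a (8 * gamma0 P a msq) / (P.L : ℝ) ^ 2)⁻¹ := inv_pos.mpr (lowConst_pos ha hL hmsq.le)
  have hσ := siteVar_le_zeroField_region_largeBlocks R C ha hL hmsq hK j hjK hs hU Λ hΛ
  refine ⟨abs_log_integral_chiFluctφ_thrF C (pieceF R j) 0 hmsq ha hLr hjK.le Λ hN hσ0 hσ hb hs hexp hsmall, ?_⟩
  have hσ0' : 0 < (min a (8 * gamma0 P a msq) / (P.L : ℝ) ^ 2)⁻¹ * P.mesh (j.val + 1) ^ (-((P.d : ℝ) - 2)) :=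
    mul_pos hσ0 (Real.rpow_pos_of_pos hm _)
  have ht : 0 ≤ thrF P.d (P.mesh (j.val + 1)) (B2.pFn b₁ p₁ (P.mesh (j.val + 1))) := by
    unfold thrF
    exact mul_nonneg (Real.rpow_nonneg hm.le _) (B1Ineq353Proof.pFn_nonneg hb.le hm hs)
  have h1 := one_sub_integral_chiFluctφ_le C (pieceF R j) 0 hmsq ha hLr hjK.le Λ hN hσ0' hσ ht
  have h2 := tail_thrF_le (n := N) (σ1sq := (min a (8 * gamma0 P a msq) / (P.L : ℝ) ^ 2)⁻¹)
    (p := B2.pFn b₁ p₁ (P.mesh (j.val + 1))) hm (Nat.cast_nonneg (Fintype.card (HiggsLattice.Site P (j.val + 1)))) hexp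
  have hkey : thrF N (P.mesh (j.val + 1)) (B2.pFn b₁ p₁ (P.mesh (j.val + 1))) ^ 2
        / (2 * N * ((min a (8 * gamma0 P a msq) / (P.L : ℝ) ^ 2)⁻¹ * P.mesh (j.val + 1) ^ (-((N : ℝ) - 2))))
      = thrF P.d (P.mesh (j.val + 1)) (B2.pFn b₁ p₁ (P.mesh (j.val + 1))) ^ 2
        / (2 * N * ((min a (8 * gamma0 P a msq) / (P.L : ℝ) ^ 2)⁻¹ * P.mesh (j.val + 1) ^ (-((P.d : ℝ) - 2)))) := by
    rw [thrF_sq_div N N hm, thrF_sq_div P.d N hm]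
  rw [hkey] at h2
  linarith

end Region

section RegularRegion

variable {N : ℕ}

open B2Eq337ScalarIntegration (Regions V)
open B2Eq328ConcretePieces (LSite pieceF)
open B2Eq328DeltaK (extL)
open B1Ineq233LowerRegularOnRegion (ineq233_lower_printed_region)

/-- **THE VARIANCE BOUND OF `φ′(y)_i` UNDER `dμ_{C^{(k)}_Λ(B^k(Λ_k),A)}` AT A BACKGROUND REGULAR ON THE REGION — print's Prop. 2.3
setting verbatim** (*"If a configuration A is regular on Ω …"*, `Ω = B^k(Λ_k)`, `Λ ⊆ Λ_k` unions of blocks): for `d`, `L > 1`,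
`a, m² > 0`, a regularity constant `c` and `N` there are `E₀ > 0` and `σ₁² > 0` (functions of `(d, L, a, m², c)` only) such that for
every charge data with `e² ≤ E₀`, every torus of the family with parameters `(d, L)`, every region tower `R`, every level
`1 ≦ k = j+1 < K ≦ K_P` with `Λ_k = R.block j` a union of blocks, `L^kε ≦ 1`, at least two `(k+1)`-sites per direction, every `A`
`δ`-regular ON `Ω = B^k(Λ_k)` with `L^kδ ≦ c|e|`, every `Λ ⊆ Λ_k`, site and component: `siteVar y i ≤ σ₁²(L^kε)^{−(d−2)}` — r14's
`ineq233_lower_printed_region` (zero extensions) through §5's supported-field variant (`σ₁² = γ⁻¹`).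
[cite: Balaban1982Higgs1, Prop. 2.3 (2.33) p.611, Prop. 2.1 (2.23) p.610] -/
theorem siteVar_le_regular_region (d L : ℕ) (hL1 : 1 < L) {a msq : ℝ} (ha : 0 < a) (hmsq : 0 < msq) (c : ℝ) (N : ℕ) :
    ∃ E₀ : ℝ, 0 < E₀ ∧ ∃ σ1sq : ℝ, 0 < σ1sq ∧
      ∀ (C : ChargeData N), C.e ^ 2 ≤ E₀ →
      ∀ (P : HiggsLattice.Params), P.d = d → P.L = L →
      ∀ {K : ℕ} (R : Regions P K), K ≤ P.K → ∀ (j : Fin K), j.val + 1 < P.K →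
      (∀ μ, 2 ≤ P.sitesPerDir (j.val + 1 + 1) μ) → P.mesh (j.val + 1) ≤ 1 →
      (∀ y y' : HiggsLattice.Site P (j.val + 1),
        HiggsLattice.blockOf y = HiggsLattice.blockOf y' → (y ∈ R.block j ↔ y' ∈ R.block j)) →
      ∀ (A : HiggsLattice.VecField P 0) {δ : ℝ}, 0 ≤ δ →
        (∀ z ∈ pieceF R j, ∀ μ' ν : Fin P.d, |A ⟨z.shift ν, μ'⟩ - A ⟨z, μ'⟩| ≤ δ) →
        (P.L : ℝ) ^ (j.val + 1) * δ ≤ c * |C.e| →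
        ∀ (Λ : Finset (HiggsLattice.Site P (j.val + 1))), Λ ⊆ R.block j →
        ∀ (y : HiggsLattice.Site P (j.val + 1)) (i : Fin N),
          siteVar P C (pieceF R j) A msq a (j.val + 1) Λ y i ≤ σ1sq * P.mesh (j.val + 1) ^ (-((P.d : ℝ) - 2)) := by
  obtain ⟨E₀, hE₀, γ, hγ, h⟩ := ineq233_lower_printed_region d L hL1 ha hmsq c N
  refine ⟨E₀, hE₀, γ⁻¹, inv_pos.mpr hγ,
    fun C heE P hPd hPL K R hK j hjK hN2 hs hU A δ hδ hreg hu Λ hΛ y i => ?_⟩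
  have hLr : (1 : ℝ) < (P.L : ℝ) := by rw [hPL]; exact_mod_cast hL1
  refine siteVar_le_of_ineq233_lower_supported C (pieceF R j) A hmsq ha hLr hjK.le (R.block j) Λ hΛ hγ
    (fun f hf => ?_) y i
  have h1 := h C heE P hPd hPL R hK j hjK hN2 hs hU A hδ hreg hu (fun y : LSite R j => f y.1)
  rwa [extL_restrict_of_supported R j f hf] at h1

/-- **LEAF (a) FOR THE SCALAR FACTOR UNDER `dμ_{C^{(k)}_Λ(B^k(Λ_k),A)}` AT A BACKGROUND REGULAR ON THE REGION, PRINTED FORM**: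
for `d`, `L > 1`, `a, m² > 0`, `c`, `N ≥ 1`, `b₁ > 0`, `p₁ > ½` and every `K'` there are `E₀ > 0` and `s₁ > 0` (functions of these
numbers only) such that — for every charge data with `e² ≤ E₀`, every torus `(d, L)`, region tower, level `1 ≦ k = j+1 < K ≦ K_P`
with `Λ_k` a union of blocks, `L^kε ≤ s₁`, at least two `(k+1)`-sites per direction, `A` `δ`-regular on `B^k(Λ_k)` with `L^kδ ≦ c|e|`,
every `Λ ⊆ Λ_k`, and `2N|T^{(k)}|(L^kε)^{K'} ≤ ½` — `|log⟨χ(φ′)⟩| ≤ 4N|T^{(k)}|(L^kε)^{K'}`: the (3.59)-type leaf (a) in the setting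
Prop. 2.3 is printed for, no covariance hypothesis left. [cite: Balaban1982Higgs1, (3.59) p.623, Prop. 2.3 (2.33) p.611] -/
theorem abs_log_integral_chiFluctφ_regular_region_printed (d L : ℕ) (hL1 : 1 < L) {a msq : ℝ} (ha : 0 < a)
    (hmsq : 0 < msq) (c : ℝ) {N : ℕ} (hN : 0 < N) {b₁ p₁ : ℝ} (hb : 0 < b₁) (hp : 1 / 2 < p₁) (K' : ℕ) :
    ∃ E₀ : ℝ, 0 < E₀ ∧ ∃ s₁ : ℝ, 0 < s₁ ∧
      ∀ (C : ChargeData N), C.e ^ 2 ≤ E₀ →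
      ∀ (P : HiggsLattice.Params), P.d = d → P.L = L →
      ∀ {K : ℕ} (R : Regions P K), K ≤ P.K → ∀ (j : Fin K), j.val + 1 < P.K →
      (∀ μ, 2 ≤ P.sitesPerDir (j.val + 1 + 1) μ) → P.mesh (j.val + 1) ≤ s₁ →
      (∀ y y' : HiggsLattice.Site P (j.val + 1),
        HiggsLattice.blockOf y = HiggsLattice.blockOf y' → (y ∈ R.block j ↔ y' ∈ R.block j)) →
      ∀ (A : HiggsLattice.VecField P 0) {δ : ℝ}, 0 ≤ δ →
        (∀ z ∈ pieceF R j, ∀ μ' ν : Fin P.d, |A ⟨z.shift ν, μ'⟩ - A ⟨z, μ'⟩| ≤ δ) →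
        (P.L : ℝ) ^ (j.val + 1) * δ ≤ c * |C.e| →
        ∀ (Λ : Finset (HiggsLattice.Site P (j.val + 1))), Λ ⊆ R.block j →
          2 * N * Fintype.card (HiggsLattice.Site P (j.val + 1)) * P.mesh (j.val + 1) ^ K' ≤ 1 / 2 →
          |Real.log (∫ x, chiFluctφ (thrF P.d (P.mesh (j.val + 1)) (B2.pFn b₁ p₁ (P.mesh (j.val + 1)))) (fieldOfCrd Λ x)
              ∂(condGauss C (pieceF R j) A msq a (j.val + 1) Λ))|
            ≤ 4 * N * Fintype.card (HiggsLattice.Site P (j.val + 1)) * P.mesh (j.val + 1) ^ K' := by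
  obtain ⟨E₀, hE₀, σ1sq, hσ, hvar⟩ := siteVar_le_regular_region d L hL1 ha hmsq c N
  obtain ⟨s₁, hs₁, h⟩ := exp_neg_pFn_sq_le_pow hN hσ hb hp K'
  refine ⟨E₀, hE₀, min s₁ 1, lt_min hs₁ one_pos,
    fun C heE P hPd hPL K R hK j hjK hN2 hs hU A δ hδ hreg hu Λ hΛ hsmall => ?_⟩
  have hLr : (1 : ℝ) < (P.L : ℝ) := by rw [hPL]; exact_mod_cast hL1
  have hm : 0 < P.mesh (j.val + 1) := P.mesh_pos _
  have hs1 : P.mesh (j.val + 1) ≤ 1 := hs.trans (min_le_right _ _)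
  have he := h (P.mesh (j.val + 1)) hm (hs.trans (min_le_left _ _))
  exact abs_log_integral_chiFluctφ_thrF C (pieceF R j) A hmsq ha hLr hjK.le Λ hN hσ
    (hvar C heE P hPd hPL R hK j hjK hN2 hs1 hU A hδ hreg hu Λ hΛ) hb hs1 he hsmall

end RegularRegion

end

end Literature.MathematicalPhysics.QuantumFieldTheory.Balaban1983to89.B1Eq324SmallFieldLeafModels
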